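import Literature.Probability.LatticeModels.GibbsSpecificationDLRProofs
import Literature.MathematicalPhysics.QuantumFieldTheory.LatticeGaugeShenZhuZhuProofs
import HarnessLib

/-!
# `IR` — STOPPING-REGION CONSISTENCY: the strong Markov property of a specification for data-selected regions

Spine route `BalabanLadder` (route-QuantumFields-BalabanLadder), crux `IR` (stmt-QuantumFields-19354), registered line
«af-pincer-T» (skeleton 0308f95ca6f6a115); crux-idea card `slack-frame-dodging` (certideate-1 g6) typed the
predicate `StoppingRegionConsistency γ` / `StoppingRegionConsistencyOfSpecification` («to be proved») as the engine
identity that licenses placing each cut plane AFTER revealing the outer data; owner READING R47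
(`pub/ym-beyond/p2-g26-files/READINGS-R47-g26.md`): «`StoppingRegionConsistency` MAY LAND as helper».  Count-neutral
helper (`--supports stmt-QuantumFields-19354 --as helper`); no stub is claimed, no skeleton touched.

## Statement (`lintegral_stoppingRegion_eq`)

Let `γ` be a specification on `V → S` (Georgii: probability kernels, exterior measurability, properness, consistency),
`R i ⊆ Λ'` finitely many candidate sub-volumes and `τ : (V → S) → ι` a SELECTOR such that each event `{τ = i}` is
measurable for the exterior σ-algebra `𝓕_{(R i)ᶜ}` of the region it selects (the region is read off the configuration
OUTSIDE itself).  Then integrating the kernel of the SELECTED region against `γ_{Λ'}(· | η)` gives back `γ_{Λ'}(· | η)`: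
`∫⁻ σ, γ_{R (τ σ)}(A | σ) dγ_{Λ'}(· | η) = γ_{Λ'}(A | η)` for every measurable `A` — the adaptive («stopping-region»)
analogue of DLR consistency `γ_{Λ'} γ_Λ = γ_{Λ'}`.  `stoppingRegionConsistency_of_isSpecification` is the same
statement in the exact shape of the desk predicate (`∀ ι [Fintype ι] R Λ' …`), and `…_ymSpecification` the lattice
Yang–Mills instance (compact Hausdorff second-countable `G`, continuous `ρ`).

## Proof

Split along the finite measurable partition `{τ = i}`: pointwise
`γ_{R (τ σ)}(A | σ) = Σ_i 1_{τ = i}(σ) γ_{R i}(A | σ) = Σ_i γ_{R i}(A ∩ {τ = i} | σ)` by properness in set form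
(`IsSpecification.measure_inter_of_cylinderEvents`, Georgii 2011 Rem. 1.20, since `{τ = i} ∈ 𝓕_{(R i)ᶜ}`); integrate
term by term, apply consistency `γ_{Λ'} γ_{R i} = γ_{Λ'}` to each `A ∩ {τ = i}` (Georgii 2011 (1.21)) and re-assemble
the partition.  (This is the finite-valued case of the strong Markov property of Gibbs specifications; cf. Georgii
2011 §8.3 / Kozlov–Preston «random sets measurable from outside».)

Everything here is proved (no `sorry`, no new axioms).  HONEST FRAMING: pure DLR bookkeeping for a card that the
triage panel graded «content welcome, format deferred to the lead desk»; it carries none of the weight of the line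
((i_T), rarity, bridge); the conditional chain (Track A) is untouched; not a gap, not Clay.
Refs: Georgii 2011 Def. 1.23, (1.21), Rem. 1.20; Friedli–Velenik 2017 Lemma 6.13.
-/

set_option autoImplicit false

noncomputable section

open MeasureTheory
open scoped ENNReal
open Literature.Probability.LatticeModels
open Literature.MathematicalPhysics.QuantumLattice
open Literature.MathematicalPhysics.QuantumFieldTheory (isSpecification_ymSpecification_of_t2Space)

namespace Summit.QuantumFields.YangMills.Theorems.IRStoppingRegion

section Abstract

variable {V S : Type*} [MeasurableSpace S] {ι : Type*}

/-- Pointwise splitting of the selected kernel along the partition `{τ = i}`, with properness moving the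
exterior-measurable indicator inside the kernel: `γ_{R (τ σ)}(A | σ) = Σ_i γ_{R i}(A ∩ {τ = i} | σ)`. -/
theorem apply_stoppingRegion_eq_sum [Fintype ι] {γ : Specification V S} (hγ : IsSpecification γ)
    (R : ι → Finset V) (τ : (V → S) → ι)
    (hτ : ∀ i, MeasurableSet[cylinderEvents ((↑(R i) : Set V)ᶜ)] {σ : V → S | τ σ = i})
    (σ : V → S) (A : Set (V → S)) :
    γ (R (τ σ)) σ A = ∑ i, γ (R i) σ (A ∩ {σ : V → S | τ σ = i}) := by
  classical
  have h : ∀ i, γ (R i) σ (A ∩ {σ : V → S | τ σ = i}) =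
      ({σ : V → S | τ σ = i} : Set (V → S)).indicator 1 σ * γ (R i) σ A := fun i =>
    hγ.measure_inter_of_cylinderEvents (R i) A (hτ i) σ
  simp_rw [h]
  rw [Fintype.sum_eq_single (τ σ) fun i hi => by
    rw [Set.indicator_of_notMem (by simpa using (Ne.symm hi)), zero_mul]]
  rw [Set.indicator_of_mem (by simp), Pi.one_apply, one_mul]

/-- **Stopping-region consistency (strong Markov property for data-selected regions).**  For a specification `γ`,
finitely many candidate regions `R i ⊆ Λ'` and a selector `τ` with `{τ = i} ∈ 𝓕_{(R i)ᶜ}` for every `i`,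
`∫⁻ σ, γ_{R (τ σ)}(A | σ) dγ_{Λ'}(· | η) = γ_{Λ'}(A | η)` for every measurable `A` (Georgii 2011 (1.21) + Rem. 1.20). -/
theorem lintegral_stoppingRegion_eq [Fintype ι] {γ : Specification V S} (hγ : IsSpecification γ)
    (R : ι → Finset V) (Λ' : Finset V) (hR : ∀ i, R i ⊆ Λ') (τ : (V → S) → ι)
    (hτ : ∀ i, MeasurableSet[cylinderEvents ((↑(R i) : Set V)ᶜ)] {σ : V → S | τ σ = i})
    (η : V → S) (A : Set (V → S)) (hA : MeasurableSet A) :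
    ∫⁻ σ, γ (R (τ σ)) σ A ∂(γ Λ' η) = γ Λ' η A := by
  classical
  have hBi : ∀ i, MeasurableSet ({σ : V → S | τ σ = i} : Set (V → S)) := fun i =>
    cylinderEvents_le_pi _ (hτ i)
  have hABi : ∀ i, MeasurableSet (A ∩ {σ : V → S | τ σ = i}) := fun i => hA.inter (hBi i)
  simp_rw [apply_stoppingRegion_eq_sum hγ R τ hτ _ A]
  rw [lintegral_finsetSum _ fun i _ => hγ.measurable_coe (R i) (hABi i)]
  simp_rw [hγ.consistent (hR _) η _ (hABi _)]
  rw [← measure_biUnion_finset (fun i _ j _ hij => ?_) fun i _ => hABi i]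
  · congr 1
    ext σ
    simp only [Set.mem_iUnion, Set.mem_inter_iff, Set.mem_setOf_eq, Finset.mem_univ, exists_true_left]
    exact ⟨fun ⟨_, h, _⟩ => h, fun h => ⟨τ σ, h, rfl⟩⟩
  · exact Set.disjoint_left.2 fun σ h₁ h₂ => hij (h₁.2.symm.trans h₂.2)

/-- **Every specification has the stopping-region property** — the desk predicate
`StoppingRegionConsistencyOfSpecification` (certideate-1 g6, card `slack-frame-dodging`) in its exact quantifier
shape: `∀ ι [Fintype ι] (R : ι → Finset V) Λ', (∀ i, R i ⊆ Λ') → ∀ τ, (∀ i, {τ = i} ∈ 𝓕_{(R i)ᶜ}) →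
∀ η A, MeasurableSet A → ∫⁻ σ, γ (R (τ σ)) σ A ∂(γ Λ' η) = γ Λ' η A`. -/
theorem stoppingRegionConsistency_of_isSpecification {γ : Specification V S} (hγ : IsSpecification γ) :
    ∀ (ι : Type) [Fintype ι] (R : ι → Finset V) (Λ' : Finset V), (∀ i, R i ⊆ Λ') →
      ∀ τ : (V → S) → ι, (∀ i, MeasurableSet[cylinderEvents ((↑(R i) : Set V)ᶜ)] {σ : V → S | τ σ = i}) →
        ∀ (η : V → S) (A : Set (V → S)), MeasurableSet A →
          ∫⁻ σ, γ (R (τ σ)) σ A ∂(γ Λ' η) = γ Λ' η A :=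
  fun _ _ R Λ' hR τ hτ η A hA => lintegral_stoppingRegion_eq hγ R Λ' hR τ hτ η A hA

end Abstract

section YangMills

variable {d N : ℕ} {G : Type} [Group G] [TopologicalSpace G] [IsTopologicalGroup G] [CompactSpace G]
  [MeasurableSpace G] [BorelSpace G] [T2Space G] [SecondCountableTopology G]
  (ρ : G →* Matrix (Fin N) (Fin N) ℂ)

/-- **Stopping-region consistency for the lattice Yang–Mills kernels** `ymSpecification ρ β` on `ℤ^d` (compact
Hausdorff second-countable `G`, continuous `ρ`): for finitely many candidate link sets `R i ⊆ Λ'` and a selector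
`τ` reading the choice `{τ = i}` off the links outside `R i`,
`∫⁻ σ, γ_{R (τ σ)}(A | σ) dγ_{Λ'}(· | η) = γ_{Λ'}(A | η)`. -/
theorem lintegral_stoppingRegion_eq_ymSpecification (hρ : Continuous ρ) (β : ℝ) {ι : Type*} [Fintype ι]
    (R : ι → Finset (ZdEdge d)) (Λ' : Finset (ZdEdge d)) (hR : ∀ i, R i ⊆ Λ') (τ : LGConfig d G → ι)
    (hτ : ∀ i, MeasurableSet[cylinderEvents ((↑(R i) : Set (ZdEdge d))ᶜ)] {σ : LGConfig d G | τ σ = i})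
    (η : LGConfig d G) (A : Set (LGConfig d G)) (hA : MeasurableSet A) :
    ∫⁻ σ, ymSpecification ρ β (R (τ σ)) σ A ∂(ymSpecification ρ β Λ' η) = ymSpecification ρ β Λ' η A :=
  lintegral_stoppingRegion_eq (isSpecification_ymSpecification_of_t2Space ρ hρ β) R Λ' hR τ hτ η A hA

end YangMills

end Summit.QuantumFields.YangMills.Theorems.IRStoppingRegion

end
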